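import Summits.QuantumFields.YangMills.Theorems.UnitScaleTiltProp7PinnedRegaugeChartDivergenceTorus
import HarnessLib

/-!
# Prop 7, route-R E′, (E1-c) brick F1 — COVARIANT DIVERGENCE PRODUCT RULES IN SUP CURRENCY:
# `D*_W[b ↦ c(b₋)(B_b)](x) = c(x)(D*_WB(x)) + Σ_μ [transported coefficient − c(x)](B̃_μ)`, the crude two-data rule, and their operator-norm bounds

Route `UnitScaleTilt`, crux K1 child «MinimiserStabilityRegPr» (`stmt-QuantumFields-19200`), cell ym3-torus, width seat px15 (gen 2); pen «px15 g2: (E1-c) GO-LOCATE» (★p1 g15,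
2026-08-28T20:45:05Z), LOCATE `LOCATE-E1C-DIVLIPSCHITZ-px15g2.md` §2∕§4 (F1).  THEOREMS ONLY (0 `def`, 0 `sorry`); `--supports stmt-QuantumFields-19200`, count-neutral.
YM₃ on T³ is a ladder rung (R3), not the Clay problem; nothing here claims the stub, the crux, d = 4 or the mass gap.

WHY.  The exact corrector (E1) is a Banach fixed point (✓ `Prop7ExactCorrectorContraction.exists_unique_exact_corrector`, ✓ `Prop7ExactCorrectorContractionGauge.…_gauge`) whose
nonlinearity `N(ψ)` — the chart remainder of `(X‴)^{e^{−iψ}}` — must be Lipschitz in the Y-gauge `max(ℓ·sup|·|, ℓ²·sup|D*_W ·|)` (★routeR-w3's LOCATE-E1 §3).  The divergence of `N` is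
a sum of terms of two kinds: a SITE COEFFICIENT applied to ONE bond datum (`(Ad(e^{−iψ}) − 1)(iD‴)`, `M_ψ(iD_Wψ)`), whose divergence RESUMS to the coefficient applied to the
datum's divergence plus a first-difference correction; and products of TWO `ℓ⁻¹`-small bond data, whose divergence is bounded crudely.  This file is the lattice bookkeeping of both
rules, in the abstract `T∕U` letters of ✓ `B9Eq39Adjoint` read through an `SU(n)`-valued background (✓ `Prop7PinnedRegaugeChartDivergenceTorus` pattern) and then in the doors'
torus letters `divB (torusT P i) (unitsField∘toUField W)`.

WHAT IS PROVED (def-free; ns `…Theorems.Prop7CovDivProductRules`).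
* §1 (abstract: finite site set `S`, directions `ι`, bijective shifts `T`, unit-valued `U` agreeing with `SU(n)`-valued `W`)
  `covDstar_apply_coeff` (one direction), ★★ `divB_siteCoeff_eq` — for ANY site-indexed family of ADDITIVE maps `c x : M_n(ℂ) → M_n(ℂ)`:
  `D*(c·B)(x) = c x (D*B(x)) + Σ_μ [R⁻¹(c y (B_μ y)) − c x (R⁻¹(B_μ y))]`, `y = x − e_μ`;  ★★ `divB_siteCoeff_eq_of_equivariant` — for `c y = ĉ(ψ y)` with `ĉ` EQUIVARIANT under the
  reversed-bond transport (`R⁻¹(ĉ λ Z) = ĉ (R⁻¹λ) (R⁻¹Z)`): the bracket is `(ĉ(ψ̃_μ) − ĉ(ψ x))(B̃_μ)` with `ψ̃_μ − ψ x = (D*_μψ)(x)` — a FIRST covariant difference;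
  ★★ `norm_divB_siteCoeff_le` — `‖D*(ĉ(ψ)B)(x)‖ ≤ ν·‖D*B(x)‖ + κ·Σ_μ ‖(D*_μψ)(x)‖·‖B_μ(x − e_μ)‖` under `‖ĉ λ Z‖ ≤ ν‖Z‖`, `‖ĉ λ Z − ĉ λ′ Z‖ ≤ κ‖λ − λ′‖‖Z‖`;
  `norm_divB_le_sum` (crude: `‖D*P(x)‖ ≤ Σ_μ(‖P_μ(x−e_μ)‖ + ‖P_μ(x)‖)`), ★ `norm_divB_mul_le` (two data: `‖D*(B·B′)(x)‖ ≤ Σ_μ(‖B_μ(x−e_μ)‖‖B′_μ(x−e_μ)‖ + ‖B_μ x‖‖B′_μ x‖)`).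
* §2 (the doors' torus letters, any `P i`, `SU(N)`) `divB_siteCoeff_eq_torus`, ★★★ `norm_divB_siteCoeff_le_torus` (sup form: `≤ ν·‖D*_WB(x)‖ + κ·d·(sup_b‖D_Wψ‖)·(sup_b‖B‖)`),
  ★ `norm_divB_mul_le_torus` (`≤ 2d·sup‖B‖·sup‖B′‖`).
HONEST SCOPE.  Lattice algebra + triangle inequalities; no BCH, no analysis; constants ours.  F2 (trisection of `N`), F3 (`dexp` letter), F4 (the (E1-c) row) are separate files.

References: T. Bałaban, CMP 99 (1985) 389–434 [Balaban1985BackgroundPropagators] ((3.3)–(3.8) pp.390–392, gauge covariance p.393); CMP 102 (1985) 277–309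
[Balaban1985Variational] ((141)–(143) p.299, Prop. 7 p.299); CMP 98 (1985) 17–51 [Balaban1985Averaging] ((19)–(21) p.21).
-/

set_option autoImplicit false

noncomputable section

open scoped BigOperators Matrix.Norms.L2Operator Matrix
open NormedSpace

namespace Summit.QuantumFields.YangMills.Theorems.Prop7CovDivProductRules

open Literature.MathematicalPhysics.QuantumFieldTheory.Balaban1983to89
open Finset B1RG242Torus
open B9Eq39Adjoint (R R_def R_add R_sub covD covDstar divB)
open B10Eq27TorusAxialLog (unitsField toUField)
open B9TorusCalculus (torusT)
open Summit.QuantumFields.YangMills.Theorems.Prop7PinnedRegaugeChartDivergence (R_inv_eq_star_mul)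
open Summit.QuantumFields.YangMills.Theorems.Prop7PinnedRegaugeChartDivergenceTorus (norm_R_inv_eq coe_unitsField_toUField covDstar_apply_shift)

/-! ## §1 Abstract lattice: site coefficients, equivariance, the two rules -/

section Abstract

variable {n : Type*} [Fintype n] [DecidableEq n] [Nonempty n]
variable {S : Type*} {ι : Type*} (T : ι → Equiv.Perm S) (U : ι → S → (Matrix n n ℂ)ˣ)
  (W : ι → S → Matrix.specialUnitaryGroup n ℂ)

omit [Nonempty n] in
/-- ONE DIRECTION: `D*_μ[c·G](x) = c x (D*_μG(x)) + (R⁻¹(c y (G y)) − c x (R⁻¹(G y)))`, `y = x − e_μ`, for an additive site coefficient `c x`. [folklore]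
[cite: Balaban1985BackgroundPropagators, (3.8) p.392] -/
theorem covDstar_apply_coeff (c : S → Matrix n n ℂ → Matrix n n ℂ) (hc : ∀ x Z Z', c x (Z - Z') = c x Z - c x Z')
    (μ : ι) (G : S → Matrix n n ℂ) (x : S) :
    covDstar T U μ (fun y => c y (G y)) x
      = c x (covDstar T U μ G x)
        + (R (U μ ((T μ).symm x))⁻¹ (c ((T μ).symm x) (G ((T μ).symm x))) - c x (R (U μ ((T μ).symm x))⁻¹ (G ((T μ).symm x)))) := by
  simp only [covDstar, hc]
  abel

variable [Fintype ι]

omit [Nonempty n] in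
/-- ★★ **THE PRODUCT RULE FOR A SITE COEFFICIENT (algebraic form).**  For ANY site-indexed family of additive maps `c x` and bond field `B`:
`D*(c·B)(x) = c x (D*B(x)) + Σ_μ [R⁻¹(c y_μ (B_μ y_μ)) − c x (R⁻¹(B_μ y_μ))]`, `y_μ = x − e_μ`. [folklore] [cite: Balaban1985BackgroundPropagators, (3.8) p.392] -/
theorem divB_siteCoeff_eq (c : S → Matrix n n ℂ → Matrix n n ℂ) (hc : ∀ x Z Z', c x (Z - Z') = c x Z - c x Z')
    (hcsum : ∀ x (f : ι → Matrix n n ℂ), c x (∑ μ, f μ) = ∑ μ, c x (f μ))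
    (B : ι → S → Matrix n n ℂ) (x : S) :
    divB T U (fun μ y => c y (B μ y)) x
      = c x (divB T U B x)
        + ∑ μ, (R (U μ ((T μ).symm x))⁻¹ (c ((T μ).symm x) (B μ ((T μ).symm x))) - c x (R (U μ ((T μ).symm x))⁻¹ (B μ ((T μ).symm x)))) := by
  simp only [divB, covDstar_apply_coeff T U c hc, Finset.sum_add_distrib, hcsum]

omit [Nonempty n] in
/-- ★★ **THE PRODUCT RULE FOR AN EQUIVARIANT COEFFICIENT OF A SITE FIELD.**  `c y = ĉ (ψ y)` with `ĉ` additive in its second slot and EQUIVARIANT under the reversed-bond transports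
(`R⁻¹(ĉ λ Z) = ĉ (R⁻¹λ) (R⁻¹Z)`).  Then the correction term is `(ĉ(ψ̃_μ) − ĉ(ψ x))(B̃_μ)` with `ψ̃_μ = R⁻¹ψ(y_μ) = ψ x + (D*_μψ)(x)`, `B̃_μ = R⁻¹B_μ(y_μ)`:
`D*(ĉ(ψ)B)(x) = ĉ (ψ x) (D*B(x)) + Σ_μ [ĉ (ψ x + (D*_μψ)(x)) (B̃_μ) − ĉ (ψ x) (B̃_μ)]`. [cite: Balaban1985BackgroundPropagators, (3.8) p.392, p.393] -/
theorem divB_siteCoeff_eq_of_equivariant (ĉ : Matrix n n ℂ → Matrix n n ℂ → Matrix n n ℂ) (hĉ : ∀ lam Z Z', ĉ lam (Z - Z') = ĉ lam Z - ĉ lam Z')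
    (hĉsum : ∀ lam (f : ι → Matrix n n ℂ), ĉ lam (∑ μ, f μ) = ∑ μ, ĉ lam (f μ))
    (hequiv : ∀ μ y lam Z, R (U μ y)⁻¹ (ĉ lam Z) = ĉ (R (U μ y)⁻¹ lam) (R (U μ y)⁻¹ Z))
    (ψ : S → Matrix n n ℂ) (B : ι → S → Matrix n n ℂ) (x : S) :
    divB T U (fun μ y => ĉ (ψ y) (B μ y)) x
      = ĉ (ψ x) (divB T U B x)
        + ∑ μ, (ĉ (ψ x + covDstar T U μ ψ x) (R (U μ ((T μ).symm x))⁻¹ (B μ ((T μ).symm x)))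
                - ĉ (ψ x) (R (U μ ((T μ).symm x))⁻¹ (B μ ((T μ).symm x)))) := by
  rw [divB_siteCoeff_eq T U (fun y => ĉ (ψ y)) (fun y => hĉ (ψ y)) (fun y => hĉsum (ψ y)) B x]
  congr 1
  refine Finset.sum_congr rfl fun μ _ => ?_
  rw [hequiv]
  congr 2
  simp only [covDstar]
  abel

/-- ★★ **THE PRODUCT RULE, OPERATOR-NORM FORM.**  Under `‖ĉ λ Z‖ ≤ ν‖Z‖` (for all `λ` — state the window outside if needed) and the Lipschitz row `‖ĉ λ Z − ĉ λ′ Z‖ ≤ κ‖λ − λ′‖‖Z‖`: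
`‖D*(ĉ(ψ)B)(x)‖ ≤ ν·‖D*B(x)‖ + κ·Σ_μ ‖(D*_μψ)(x)‖·‖B_μ(x − e_μ)‖` (transport is an isometry). [cite: Balaban1985BackgroundPropagators, (3.8) p.392] -/
theorem norm_divB_siteCoeff_le (hUW : ∀ μ x, (U μ x : Matrix n n ℂ) = (W μ x : Matrix n n ℂ))
    (ĉ : Matrix n n ℂ → Matrix n n ℂ → Matrix n n ℂ) (hĉ : ∀ lam Z Z', ĉ lam (Z - Z') = ĉ lam Z - ĉ lam Z')
    (hĉsum : ∀ lam (f : ι → Matrix n n ℂ), ĉ lam (∑ μ, f μ) = ∑ μ, ĉ lam (f μ))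
    (hequiv : ∀ μ y lam Z, R (U μ y)⁻¹ (ĉ lam Z) = ĉ (R (U μ y)⁻¹ lam) (R (U μ y)⁻¹ Z))
    {ν κ : ℝ} (hν : ∀ lam Z, ‖ĉ lam Z‖ ≤ ν * ‖Z‖) (hκ : ∀ lam lam' Z, ‖ĉ lam Z - ĉ lam' Z‖ ≤ κ * ‖lam - lam'‖ * ‖Z‖)
    (ψ : S → Matrix n n ℂ) (B : ι → S → Matrix n n ℂ) (x : S) :
    ‖divB T U (fun μ y => ĉ (ψ y) (B μ y)) x‖
      ≤ ν * ‖divB T U B x‖ + κ * ∑ μ, ‖covDstar T U μ ψ x‖ * ‖B μ ((T μ).symm x)‖ := by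
  rw [divB_siteCoeff_eq_of_equivariant T U ĉ hĉ hĉsum hequiv ψ B x]
  refine (norm_add_le _ _).trans (add_le_add (hν _ _) ?_)
  rw [Finset.mul_sum]
  refine (norm_sum_le _ _).trans (Finset.sum_le_sum fun μ _ => ?_)
  have h := hκ (ψ x + covDstar T U μ ψ x) (ψ x) (R (U μ ((T μ).symm x))⁻¹ (B μ ((T μ).symm x)))
  rw [add_sub_cancel_left, norm_R_inv_eq U W hUW] at h
  calc _ ≤ κ * ‖covDstar T U μ ψ x‖ * ‖B μ ((T μ).symm x)‖ := h
    _ = κ * (‖covDstar T U μ ψ x‖ * ‖B μ ((T μ).symm x)‖) := by ring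

omit [Nonempty n] [Fintype ι] in
/-- `‖(D*_μP_μ)(x)‖ ≤ ‖P_μ(x − e_μ)‖ + ‖P_μ(x)‖` (isometric transport). [folklore] -/
theorem norm_covDstar_le_add [Nonempty n] (hUW : ∀ μ x, (U μ x : Matrix n n ℂ) = (W μ x : Matrix n n ℂ)) (μ : ι) (G : S → Matrix n n ℂ) (x : S) :
    ‖covDstar T U μ G x‖ ≤ ‖G ((T μ).symm x)‖ + ‖G x‖ := by
  unfold covDstar
  exact (norm_sub_le _ _).trans (by rw [norm_R_inv_eq U W hUW])

/-- **THE CRUDE RULE**: `‖D*P(x)‖ ≤ Σ_μ (‖P_μ(x − e_μ)‖ + ‖P_μ(x)‖)`. [folklore] [cite: Balaban1985BackgroundPropagators, (3.8) p.392] -/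
theorem norm_divB_le_sum (hUW : ∀ μ x, (U μ x : Matrix n n ℂ) = (W μ x : Matrix n n ℂ)) (P : ι → S → Matrix n n ℂ) (x : S) :
    ‖divB T U P x‖ ≤ ∑ μ, (‖P μ ((T μ).symm x)‖ + ‖P μ x‖) := by
  unfold divB
  exact (norm_sum_le _ _).trans (Finset.sum_le_sum fun μ _ => norm_covDstar_le_add T U W hUW μ (P μ) x)

/-- ★ **THE CRUDE RULE FOR TWO BOND DATA**: `‖D*(B·B′)(x)‖ ≤ Σ_μ (‖B_μ(x−e_μ)‖·‖B′_μ(x−e_μ)‖ + ‖B_μ(x)‖·‖B′_μ(x)‖)` — no gain, none needed when both data are `ℓ⁻¹`-small.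
[cite: Balaban1985BackgroundPropagators, (3.8) p.392] -/
theorem norm_divB_mul_le (hUW : ∀ μ x, (U μ x : Matrix n n ℂ) = (W μ x : Matrix n n ℂ)) (B B' : ι → S → Matrix n n ℂ) (x : S) :
    ‖divB T U (fun μ y => B μ y * B' μ y) x‖
      ≤ ∑ μ, (‖B μ ((T μ).symm x)‖ * ‖B' μ ((T μ).symm x)‖ + ‖B μ x‖ * ‖B' μ x‖) := by
  refine (norm_divB_le_sum T U W hUW _ x).trans (Finset.sum_le_sum fun μ _ => ?_)
  exact add_le_add (norm_mul_le _ _) (norm_mul_le _ _)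

end Abstract

/-! ## §2 The doors' torus letters -/

section Torus

variable {P : Params} {N : ℕ} [NeZero N] {i : ℕ}

omit [NeZero N] in
/-- The reversed-bond transport on the torus in matrices: `R(U_κ(y))⁻¹Z = W_{(y,κ)}*·Z·W_{(y,κ)}`. (bookkeeping) [cite: Balaban1985BackgroundPropagators, (3.5) p.391] -/
theorem R_inv_torus (W : GaugeField P i (Matrix.specialUnitaryGroup (Fin N) ℂ)) (κ : Fin P.d) (y : Site P i) (Z : Matrix (Fin N) (Fin N) ℂ) :
    R ((fun κ z => unitsField (toUField W) ⟨z, κ⟩) κ y)⁻¹ Z = star ((W ⟨y, κ⟩ : Matrix.specialUnitaryGroup (Fin N) ℂ) : Matrix (Fin N) (Fin N) ℂ) * Z * ((W ⟨y, κ⟩ : Matrix.specialUnitaryGroup (Fin N) ℂ) : Matrix (Fin N) (Fin N) ℂ) :=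
  R_inv_eq_star_mul (fun κ z => unitsField (toUField W) ⟨z, κ⟩) (fun κ z => W ⟨z, κ⟩) (coe_unitsField_toUField W) κ y Z

/-- ★★★ **THE PRODUCT RULE ON THE TORUS, SUP FORM.**  `W : GaugeField P i SU(N)`; `ĉ` additive and sum-preserving in its second slot, EQUIVARIANT under `SU(N)`-conjugation
(`g*(ĉ λ Z)g = ĉ (g*λg) (g*Zg)` for `g ∈ SU(N)`), with `‖ĉ λ Z‖ ≤ ν‖Z‖` and `‖ĉ λ Z − ĉ λ′ Z‖ ≤ κ‖λ−λ′‖‖Z‖` (`κ ≥ 0`); `ψ` a site field with `‖(D_Wψ)(b)‖ ≤ ρ₁` and `B` a bond field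
with `‖B_b‖ ≤ β`.  Then at every site `‖D*_W(ĉ(ψ)B)(x)‖ ≤ ν·‖D*_WB(x)‖ + κ·d·ρ₁·β` — in the (E1) gauges: `ℓ²sup|D*_W(ĉ(ψ)B)| ≤ ν·ℓ²sup|D*_WB| + dκ·(ℓsup|D_Wψ|)·(ℓsup|B|)`.
[cite: Balaban1985BackgroundPropagators, (3.8) p.392, p.393] [cite: Balaban1985Variational, (141)-(143) p.299] -/
theorem norm_divB_siteCoeff_le_torus (W : GaugeField P i (Matrix.specialUnitaryGroup (Fin N) ℂ))
    (ĉ : Matrix (Fin N) (Fin N) ℂ → Matrix (Fin N) (Fin N) ℂ → Matrix (Fin N) (Fin N) ℂ) (hĉ : ∀ lam Z Z', ĉ lam (Z - Z') = ĉ lam Z - ĉ lam Z')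
    (hĉsum : ∀ lam (f : Fin P.d → Matrix (Fin N) (Fin N) ℂ), ĉ lam (∑ μ, f μ) = ∑ μ, ĉ lam (f μ))
    (hequiv : ∀ (g : Matrix.specialUnitaryGroup (Fin N) ℂ) lam Z,
        star (g : Matrix (Fin N) (Fin N) ℂ) * ĉ lam Z * (g : Matrix (Fin N) (Fin N) ℂ)
          = ĉ (star (g : Matrix (Fin N) (Fin N) ℂ) * lam * (g : Matrix (Fin N) (Fin N) ℂ)) (star (g : Matrix (Fin N) (Fin N) ℂ) * Z * (g : Matrix (Fin N) (Fin N) ℂ)))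
    {ν κ : ℝ} (hν : ∀ lam Z, ‖ĉ lam Z‖ ≤ ν * ‖Z‖) (hκ0 : 0 ≤ κ) (hκ : ∀ lam lam' Z, ‖ĉ lam Z - ĉ lam' Z‖ ≤ κ * ‖lam - lam'‖ * ‖Z‖)
    (ψ : Site P i → Matrix (Fin N) (Fin N) ℂ) (B : PBond P i → Matrix (Fin N) (Fin N) ℂ) {ρ₁ β : ℝ}
    (hψ : ∀ b : PBond P i, ‖covD (torusT P i) (fun κ z => unitsField (toUField W) ⟨z, κ⟩) b.dir ψ b.src‖ ≤ ρ₁) (hB : ∀ b : PBond P i, ‖B b‖ ≤ β) (x : Site P i) :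
    ‖divB (torusT P i) (fun κ z => unitsField (toUField W) ⟨z, κ⟩) (fun κ z => ĉ (ψ z) (B ⟨z, κ⟩)) x‖
      ≤ ν * ‖divB (torusT P i) (fun κ z => unitsField (toUField W) ⟨z, κ⟩) (fun κ z => B ⟨z, κ⟩) x‖ + κ * (P.d * (ρ₁ * β)) := by
  have hUW := coe_unitsField_toUField W
  have hequiv' : ∀ (μ : Fin P.d) (y : Site P i) lam Z, R ((fun κ z => unitsField (toUField W) ⟨z, κ⟩) μ y)⁻¹ (ĉ lam Z)
      = ĉ (R ((fun κ z => unitsField (toUField W) ⟨z, κ⟩) μ y)⁻¹ lam) (R ((fun κ z => unitsField (toUField W) ⟨z, κ⟩) μ y)⁻¹ Z) := by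
    intro μ y lam Z
    rw [R_inv_torus, R_inv_torus, R_inv_torus]
    exact hequiv (W ⟨y, μ⟩) lam Z
  have h := norm_divB_siteCoeff_le (torusT P i) (fun κ z => unitsField (toUField W) ⟨z, κ⟩) (fun κ z => W ⟨z, κ⟩) hUW ĉ hĉ hĉsum hequiv' hν hκ ψ
    (fun κ z => B ⟨z, κ⟩) x
  refine h.trans (add_le_add le_rfl ?_)
  refine mul_le_mul_of_nonneg_left ?_ hκ0
  -- each summand `‖D*_μψ(x)‖·‖B(x−e_μ, μ)‖ ≤ ρ₁·β`: `‖D*_μψ(x)‖ = ‖D_μψ(x − e_μ)‖ ≤ ρ₁`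
  have hterm : ∀ μ : Fin P.d, ‖covDstar (torusT P i) (fun κ z => unitsField (toUField W) ⟨z, κ⟩) μ ψ x‖ * ‖B ⟨(torusT P i μ).symm x, μ⟩‖ ≤ ρ₁ * β := by
    intro μ
    have e1 : x = torusT P i μ ((torusT P i μ).symm x) := ((torusT P i μ).apply_symm_apply x).symm
    have hD : ‖covDstar (torusT P i) (fun κ z => unitsField (toUField W) ⟨z, κ⟩) μ ψ x‖ ≤ ρ₁ := by
      rw [e1, covDstar_apply_shift, norm_neg, norm_R_inv_eq (fun κ z => unitsField (toUField W) ⟨z, κ⟩) (fun κ z => W ⟨z, κ⟩) hUW]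
      exact hψ ⟨(torusT P i μ).symm x, μ⟩
    have hρ0 : 0 ≤ ρ₁ := (norm_nonneg _).trans hD
    exact mul_le_mul hD (hB _) (norm_nonneg _) hρ0
  calc ∑ μ : Fin P.d, ‖covDstar (torusT P i) (fun κ z => unitsField (toUField W) ⟨z, κ⟩) μ ψ x‖ * ‖B ⟨(torusT P i μ).symm x, μ⟩‖
      ≤ ∑ _μ : Fin P.d, ρ₁ * β := Finset.sum_le_sum fun μ _ => hterm μ
    _ = P.d * (ρ₁ * β) := by simp

/-- ★ **THE CRUDE RULE ON THE TORUS, SUP FORM**: `‖D*_W(B·B′)(x)‖ ≤ 2d·β·β′` for `‖B_b‖ ≤ β`, `‖B′_b‖ ≤ β′` — in the (E1) gauges `ℓ²sup|D*_W(BB′)| ≤ 2d·(ℓsup|B|)(ℓsup|B′|)`.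
[cite: Balaban1985BackgroundPropagators, (3.8) p.392] -/
theorem norm_divB_mul_le_torus (W : GaugeField P i (Matrix.specialUnitaryGroup (Fin N) ℂ)) (B B' : PBond P i → Matrix (Fin N) (Fin N) ℂ) {β β' : ℝ}
    (hB : ∀ b : PBond P i, ‖B b‖ ≤ β) (hB' : ∀ b : PBond P i, ‖B' b‖ ≤ β') (x : Site P i) :
    ‖divB (torusT P i) (fun κ z => unitsField (toUField W) ⟨z, κ⟩) (fun κ z => B ⟨z, κ⟩ * B' ⟨z, κ⟩) x‖ ≤ 2 * P.d * (β * β') := by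
  have hUW := coe_unitsField_toUField W
  have h := norm_divB_mul_le (torusT P i) (fun κ z => unitsField (toUField W) ⟨z, κ⟩) (fun κ z => W ⟨z, κ⟩) hUW
    (fun κ z => B ⟨z, κ⟩) (fun κ z => B' ⟨z, κ⟩) x
  refine h.trans ?_
  have hβ0 : 0 ≤ β := (norm_nonneg _).trans (hB ⟨x, 0⟩)
  have hpt : ∀ μ : Fin P.d, ‖B ⟨(torusT P i μ).symm x, μ⟩‖ * ‖B' ⟨(torusT P i μ).symm x, μ⟩‖ + ‖B ⟨x, μ⟩‖ * ‖B' ⟨x, μ⟩‖ ≤ 2 * (β * β') := fun μ => by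
    have h1 := mul_le_mul (hB ⟨(torusT P i μ).symm x, μ⟩) (hB' ⟨(torusT P i μ).symm x, μ⟩) (norm_nonneg _) hβ0
    have h2 := mul_le_mul (hB ⟨x, μ⟩) (hB' ⟨x, μ⟩) (norm_nonneg _) hβ0
    linarith
  calc _ ≤ ∑ _μ : Fin P.d, 2 * (β * β') := Finset.sum_le_sum fun μ _ => hpt μ
    _ = 2 * P.d * (β * β') := by simp; ring

end Torus

end Summit.QuantumFields.YangMills.Theorems.Prop7CovDivProductRules

end
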